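import Literature.MathematicalPhysics.QuantumFieldTheory.Balaban1983to89.T4LoopHolonomyHaarLaw
import Literature.MathematicalPhysics.QuantumFieldTheory.Balaban1983to89.T4WilsonLinkAffine

/-!
# `Balaban1983to89.PlaquetteVariableHaarLaw` — THE LAW OF ONE PLAQUETTE VARIABLE `U ↦ U(∂p)` UNDER THE PRODUCT HAAR MEASURE
# `dU = Π_b dU(b)` IS HAAR MEASURE; hence every Haar-null set of the group is `dU`-null when read through any plaquette, and so is
# «some plaquette variable lies in it» (finitely many plaquettes)

Kernel measure theory over the cell's `Setup` (`GaugeField`, `GaugeField.plaqHol`, `fieldMeasure P j G = Measure.pi (fun _ ↦ HaarData.haar)`,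
the `HaarData` field `map_mul_right`), tags [BrockerTomDieck1985] I (5.12)–(5.13) (invariance of the normalised Haar integral) ∕
[Balaban1985Averaging] (5), (10) pp. 18–19 (plaquettes, `dU`); generic gauge group `G` (`[GaugeGroup G] [MeasurableSpace G] [HaarData G]
[MeasurableMul₂ G] [MeasurableInv G]`), every `Params`, every level.  Nothing of Bałaban's analysis is asserted.  Cell `pub-ymgap` (YM-PLAN
Track A, DAG node N09; seat `pub-ymgap-dag-n09-w1` g4), count-neutral helper keyed to K1⁷ `stmt-QuantumFields-20542`.

WHY.  Second brick of (F2) of `pub-ymgap-node00-def-K0e/P7-LOCATOR-AUDIT.md` §4 (the level-set nullity input behind the β-version proviso of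
the record ∕ N09's analytic binder `hreg`): the group-level nullity `Haar{g : dist1 g = r} = 0` (sibling module `HaarEigenvalueSphereNull`)
becomes a statement about CONFIGURATIONS — `dU{U : |U(∂p) − 1| = r for some p} = 0` — once the law of a plaquette variable under `dU` is
known to be Haar measure.  That law is the content of this file; it is the plaquette twin of `T4LoopHolonomyHaarLaw.map_loopHol` (law of a
`ClosedLoopIn` holonomy), keyed directly to `Plaq` ∕ `GaugeField.plaqHol` so that consumers need no loop bookkeeping.

THE ARGUMENT.  `U(∂p) = U(b₁)U(b₂)U(b₃)⁻¹U(b₄)⁻¹` with the four letters `b₁, …, b₄` of `∂p` pairwise distinct on every torus of `Params`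
(`T4WilsonLinkAffine.bond₁…bond₄`, `bond₁_ne_bond₂` …: directions `μ < ν`, and `x + e_ν ≠ x` since every side count `2·L^{m+K−j}` is `≥ 2`);
so replacing the `b₁`-variable by `g` gives `U[b₁ ↦ g](∂p) = g · t(U)` with `t(U)` blind to `U(b₁)` (`plaqHol_update_bond₁`); integrating the
`b₁`-variable first (Mathlib's iterated marginals `lintegral_eq_lmarginal_univ`, `lmarginal_erase'`) and using right invariance of Haar
measure gives `∫ f(U(∂p)) dU = ∫ f dHaar` for every measurable `f ≥ 0`, i.e. `(dU).map (U ↦ U(∂p)) = Haar`.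

WHAT IS PROVED (theorems only; 0 definitions; 0 sorry; axioms standard).
* §1 `plaqHol_eq_bonds` (`rfl`), `plaqHol_update_bond₁` (`U[b₁ ↦ g](∂p) = g · (U(b₂)U(b₃)⁻¹U(b₄)⁻¹)`).
* §2 `lintegral_haar_comp_plaqHol_update`, ★ `lintegral_comp_plaqHol` (`∫ f(U(∂p)) dU = ∫ f dHaar`), ★★ `map_plaqHol`
  (`(fieldMeasure P j G).map (· (∂p)) = HaarData.haar`), `measurePreserving_plaqHol`, `fieldMeasure_setOf_plaqHol_mem` (`dU{U(∂p) ∈ A} = Haar A`,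
  `A` measurable), ★ `fieldMeasure_setOf_plaqHol_mem_eq_zero` (`Haar A = 0 ⇒ dU{U(∂p) ∈ A} = 0`, any `A`),
  ★★ `fieldMeasure_setOf_exists_plaqHol_mem_eq_zero` (`Haar A = 0 ⇒ dU{U : ∃ p, U(∂p) ∈ A} = 0`), `ae_forall_plaqHol_not_mem`.
* §3 in `dist1` currency: `fieldMeasure_setOf_dist1_plaqHol_eq_eq_zero` ∕ ★★ `fieldMeasure_setOf_exists_dist1_plaqHol_eq_eq_zero`
  (`Haar{dist1 = r} = 0 ⇒ dU{U : ∃ p, |U(∂p) − 1| = r} = 0`) and `ae_forall_dist1_plaqHol_ne` — the group-level hypothesis is discharged for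
  `SU(n)` ∕ `U(N)` in `HaarEigenvalueSphereNull` (not imported here: this file is group-generic).

HONEST SCOPE.  Pure product-Haar bookkeeping (no Boltzmann weight, no averaging, no conditional law): the FIBRE form of (F2) (nullity for the
conditional law of the fine field given its block average) is NOT here — it needs the Jacobian face (F1) of (0.4).  Nothing of Bałaban asserted;
N09 NOT discharged; the YM mass gap (Clay) is NOT proved by any of this (R4 = conditional finite-𝕋⁴ rung `BalabanLadder.UV` only).

References: Th. Bröcker, T. tom Dieck, *Representations of Compact Lie Groups*, GTM 98 (1985) [BrockerTomDieck1985] I (5.12)–(5.13);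
T. Bałaban, Commun. Math. Phys. **98** (1985) 17–51 [Balaban1985Averaging] (5) p. 18, (10) p. 19, (19) p. 21.
-/

noncomputable section

open MeasureTheory Set Function Finset
open scoped ENNReal

namespace Literature.MathematicalPhysics.QuantumFieldTheory.Balaban1983to89.PlaquetteVariableHaarLaw

open T4WilsonLinkAffine (bond₁ bond₂ bond₃ bond₄ bond₁_ne_bond₂ bond₁_ne_bond₃ bond₁_ne_bond₄)
open Missing (measurable_plaqHol)

variable {P : Params} {j : ℕ} {G : Type*} [GaugeGroup G]

/-! ## §1 The plaquette word and its first letter -/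

/-- `U(∂p) = U(b₁)·U(b₂)·U(b₃)⁻¹·U(b₄)⁻¹` in the letters of `T4WilsonLinkAffine` (definitional). [cite: Balaban1985Averaging, (5) p.18] -/
theorem plaqHol_eq_bonds (U : GaugeField P j G) (p : Plaq P j) :
    GaugeField.plaqHol U p = U (bond₁ p) * U (bond₂ p) * (U (bond₃ p))⁻¹ * (U (bond₄ p))⁻¹ := rfl

/-- **HEAD–TAIL DECOMPOSITION**: replacing the `b₁`-variable by `g` gives `U[b₁ ↦ g](∂p) = g · (U(b₂)U(b₃)⁻¹U(b₄)⁻¹)`, the tail being blind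
to `U(b₁)` (the four letters are pairwise distinct on every torus of `Params`). [cite: Balaban1985Averaging, (5) p.18] -/
theorem plaqHol_update_bond₁ [DecidableEq (PBond P j)] (U : GaugeField P j G) (p : Plaq P j) (g : G) :
    GaugeField.plaqHol (update U (bond₁ p) g) p = g * (U (bond₂ p) * (U (bond₃ p))⁻¹ * (U (bond₄ p))⁻¹) := by
  rw [plaqHol_eq_bonds, update_self, update_of_ne (bond₁_ne_bond₂ p).symm, update_of_ne (bond₁_ne_bond₃ p).symm,
    update_of_ne (bond₁_ne_bond₄ p).symm]
  simp only [mul_assoc]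

/-! ## §2 The law of `U ↦ U(∂p)` under `dU` is Haar measure -/

section Law

variable [MeasurableSpace G] [HaarData G] [MeasurableMul₂ G] [MeasurableInv G]

omit [MeasurableInv G] in
/-- THE INNER INTEGRAL: integrating the `b₁`-variable alone already gives the Haar integral,
`∫ f(U[b₁ ↦ g](∂p)) dHaar(g) = ∫ f dHaar` (right invariance, `HaarData.map_mul_right`). [cite: BrockerTomDieck1985, I (5.13)] -/
theorem lintegral_haar_comp_plaqHol_update [DecidableEq (PBond P j)] (U : GaugeField P j G) (p : Plaq P j) {f : G → ℝ≥0∞}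
    (hf : Measurable f) :
    ∫⁻ g, f (GaugeField.plaqHol (update U (bond₁ p) g) p) ∂(HaarData.haar : Measure G) = ∫⁻ g, f g ∂(HaarData.haar : Measure G) := by
  simp only [plaqHol_update_bond₁]
  set t : G := U (bond₂ p) * (U (bond₃ p))⁻¹ * (U (bond₄ p))⁻¹
  calc ∫⁻ g, f (g * t) ∂(HaarData.haar : Measure G)
      = ∫⁻ g, f g ∂((HaarData.haar : Measure G).map (fun g : G => g * t)) := (lintegral_map hf (measurable_mul_const t)).symm
    _ = ∫⁻ g, f g ∂(HaarData.haar : Measure G) := by rw [HaarData.map_mul_right]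

/-- **`∫ f(U(∂p)) dU = ∫ f dHaar`** for every measurable `f : G → ℝ≥0∞` (peel the `b₁`-integral off the product Haar integral with Mathlib's
iterated marginals; the inner integral is the constant `∫ f dHaar`, the remaining product measure a probability measure).
[cite: Balaban1985Averaging, (10) p.19] [cite: BrockerTomDieck1985, I (5.13)] -/
theorem lintegral_comp_plaqHol (p : Plaq P j) {f : G → ℝ≥0∞} (hf : Measurable f) :
    ∫⁻ U, f (GaugeField.plaqHol U p) ∂fieldMeasure P j G = ∫⁻ g, f g ∂(HaarData.haar : Measure G) := by
  classical
  have hF : Measurable fun U : GaugeField P j G => f (GaugeField.plaqHol U p) := hf.comp (measurable_plaqHol p)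
  have e0 :
      ∫⁻ U, f (GaugeField.plaqHol U p) ∂fieldMeasure P j G =
      (∫⋯∫⁻_(univ : Finset (PBond P j)), (fun U : GaugeField P j G => f (GaugeField.plaqHol U p))
        ∂fun _ : PBond P j => (HaarData.haar : Measure G)) 1 :=
    lintegral_eq_lmarginal_univ (μ := fun _ : PBond P j => (HaarData.haar : Measure G)) 1
  have e1 := lmarginal_erase' (μ := fun _ : PBond P j => (HaarData.haar : Measure G))
    (fun U : GaugeField P j G => f (GaugeField.plaqHol U p)) hF (mem_univ (bond₁ p))
  have hc : ∀ x : PBond P j → G,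
      ∫⁻ g, f (GaugeField.plaqHol (update x (bond₁ p) g) p) ∂(HaarData.haar : Measure G) =
        ∫⁻ g, f g ∂(HaarData.haar : Measure G) :=
    fun x => lintegral_haar_comp_plaqHol_update x p hf
  rw [e0, e1]
  simp only [lmarginal]
  refine (lintegral_congr (g := fun _ => ∫⁻ g, f g ∂(HaarData.haar : Measure G)) fun y => ?_).trans ?_
  · exact hc _
  · rw [lintegral_const, measure_univ, mul_one]

/-- **THE LAW OF A PLAQUETTE VARIABLE IS HAAR MEASURE**: `(dU).map (U ↦ U(∂p)) = HaarData.haar` for every plaquette `p` of every torus.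
[cite: Balaban1985Averaging, (10) p.19] [cite: BrockerTomDieck1985, I (5.13)] -/
theorem map_plaqHol (p : Plaq P j) :
    (fieldMeasure P j G).map (fun U : GaugeField P j G => GaugeField.plaqHol U p) = (HaarData.haar : Measure G) :=
  Measure.ext_of_lintegral _ fun f hf => by
    rw [lintegral_map hf (measurable_plaqHol p)]
    exact lintegral_comp_plaqHol p hf

/-- `U ↦ U(∂p)` is measure preserving `(GaugeField, dU) → (G, Haar)`. [cite: Balaban1985Averaging, (10) p.19] -/
theorem measurePreserving_plaqHol (p : Plaq P j) :
    MeasurePreserving (fun U : GaugeField P j G => GaugeField.plaqHol U p) (fieldMeasure P j G) (HaarData.haar : Measure G) :=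
  ⟨measurable_plaqHol p, map_plaqHol p⟩

/-- `dU{U(∂p) ∈ A} = Haar A` for measurable `A ⊆ G`. [cite: Balaban1985Averaging, (10) p.19] -/
theorem fieldMeasure_setOf_plaqHol_mem (p : Plaq P j) {A : Set G} (hA : MeasurableSet A) :
    fieldMeasure P j G {U | GaugeField.plaqHol U p ∈ A} = (HaarData.haar : Measure G) A := by
  rw [← map_plaqHol (G := G) p, Measure.map_apply (measurable_plaqHol p) hA]
  rfl

/-- **EVERY HAAR-NULL SET OF THE GROUP IS `dU`-NULL THROUGH EVERY PLAQUETTE**: `Haar A = 0 ⇒ dU{U(∂p) ∈ A} = 0` (any `A`, measurable or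
not). [cite: Balaban1985Averaging, (10) p.19] -/
theorem fieldMeasure_setOf_plaqHol_mem_eq_zero (p : Plaq P j) {A : Set G} (hA : (HaarData.haar : Measure G) A = 0) :
    fieldMeasure P j G {U | GaugeField.plaqHol U p ∈ A} = 0 :=
  (measurePreserving_plaqHol p).quasiMeasurePreserving.preimage_null hA

/-- **«SOME PLAQUETTE VARIABLE LIES IN A HAAR-NULL SET» IS `dU`-NULL** (finitely many plaquettes).
[cite: Balaban1985Averaging, (10) p.19] -/
theorem fieldMeasure_setOf_exists_plaqHol_mem_eq_zero {A : Set G} (hA : (HaarData.haar : Measure G) A = 0) :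
    fieldMeasure P j G {U | ∃ p : Plaq P j, GaugeField.plaqHol U p ∈ A} = 0 := by
  have h : {U : GaugeField P j G | ∃ p : Plaq P j, GaugeField.plaqHol U p ∈ A} = ⋃ p : Plaq P j, {U | GaugeField.plaqHol U p ∈ A} := by
    ext U; simp only [Set.mem_setOf_eq, Set.mem_iUnion]
  rw [h]
  exact measure_iUnion_null fun p => fieldMeasure_setOf_plaqHol_mem_eq_zero p hA

/-- Almost-everywhere form: if `Haar A = 0` then `dU`-a.e. configuration has NO plaquette variable in `A`. [cite: Balaban1985Averaging, (10) p.19] -/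
theorem ae_forall_plaqHol_not_mem {A : Set G} (hA : (HaarData.haar : Measure G) A = 0) :
    ∀ᵐ U ∂fieldMeasure P j G, ∀ p : Plaq P j, GaugeField.plaqHol U p ∉ A := by
  rw [ae_iff]
  simpa only [not_forall, not_not] using fieldMeasure_setOf_exists_plaqHol_mem_eq_zero (P := P) (j := j) hA

end Law

/-! ## §3 In the `dist1 = |· − 1|` currency of `Setup` -/

section Dist

variable [MeasurableSpace G] [HaarData G] [MeasurableMul₂ G] [MeasurableInv G]

/-- If the `|g − 1|`-sphere of radius `r` is Haar-null, then `dU{U : |U(∂p) − 1| = r} = 0`. [cite: Balaban1985Averaging, (19) p.21] -/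
theorem fieldMeasure_setOf_dist1_plaqHol_eq_eq_zero (p : Plaq P j) {r : ℝ} (h0 : (HaarData.haar : Measure G) {g | dist1 g = r} = 0) :
    fieldMeasure P j G {U | dist1 (GaugeField.plaqHol U p) = r} = 0 :=
  fieldMeasure_setOf_plaqHol_mem_eq_zero p h0

/-- **If the `|g − 1|`-sphere of radius `r` is Haar-null, then `dU{U : ∃ p, |U(∂p) − 1| = r} = 0`** — the configurations with SOME plaquette
variable exactly at the threshold `r` form a `dU`-null set (the threshold set of the sharp small-field indicator `𝟙{|U(∂p) − 1| < r ∀p}`).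
[cite: Balaban1985Averaging, (19) p.21] [cite: Balaban1987RG1, p.259] -/
theorem fieldMeasure_setOf_exists_dist1_plaqHol_eq_eq_zero {r : ℝ} (h0 : (HaarData.haar : Measure G) {g | dist1 g = r} = 0) :
    fieldMeasure P j G {U | ∃ p : Plaq P j, dist1 (GaugeField.plaqHol U p) = r} = 0 :=
  fieldMeasure_setOf_exists_plaqHol_mem_eq_zero h0

/-- Almost-everywhere form: `dU`-a.e. `U` has `|U(∂p) − 1| ≠ r` for every plaquette `p`. [cite: Balaban1985Averaging, (19) p.21] -/
theorem ae_forall_dist1_plaqHol_ne {r : ℝ} (h0 : (HaarData.haar : Measure G) {g | dist1 g = r} = 0) :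
    ∀ᵐ U ∂fieldMeasure P j G, ∀ p : Plaq P j, dist1 (GaugeField.plaqHol U p) ≠ r :=
  ae_forall_plaqHol_not_mem h0

end Dist

end Literature.MathematicalPhysics.QuantumFieldTheory.Balaban1983to89.PlaquetteVariableHaarLaw

end
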